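import Summits.Ventures.CertifiedManyBodySolver.Theorems.M3x2EdgeSplitSymReplaySyntax
import Summits.Ventures.CertifiedManyBodySolver.Theorems.M3PrimeEdgeSplitLowerEdge_ge_m4o5WardWindowSound
import Literature.MathematicalPhysics.QuantumLattice.HubbardTTPrimeWindowCertificateAbstractState
import HarnessLib

/-!
# SymReplay checker — semantics and statements (T2 of the lb-sym checker landing)

The operator semantics of Part A (`Theorems.M3x2EdgeSplitSymReplaySyntax`) in the window algebra
`𝔄_{Λ'} = FermionOp Λ'` (`letterOp / wordOp / polyOp`), the computational crux `WardD4CertGe q` (a Ward × affine-`D₄`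
window certificate of value `≥ q` at `(t,t',U,n) = (1,0,8,7/8)` — stated against the LANDED Ward text
`Theorems.WardSlot.WardD4Identity`, hub-lb-sym-plan-2's `wardk`, no second copy), the soundness statements S1
`NfFaithful`, S2 `MoveSound`, S3 `DictionarySound` (with `HamDictSound`, `EnergyDictSound`), S4 `SymCheckSound`, and the
bookkeeping objects of the S4 proof (identification uses, the enlarged frame `bigFrame`, the dense Gram factors of the
matrix blocks). Statements/definitions only; the proofs are the `…SymReplay{NormalOrder,Moves,Dictionary,Sound…}` modules.
Source: `Cruxes/LowerEdge_ge_m83o100/Lines/symreplay.lean` rev 7 (hub-lb-sym-plan-1) + `Lines/symreplay_S4.lean`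
(hub-lb-sym-eng-3). No summit statement is proved here; nothing here predicts superconductivity.
-/

noncomputable section

namespace Summit.Ventures.CertifiedManyBodySolver.Theorems.SymReplay

open Matrix Finset
open Literature.MathematicalPhysics.QuantumLattice
open Literature.MathematicalPhysics.QuantumLattice.HubbardWave0
open Literature.MathematicalPhysics.QuantumLattice.ThermodynamicLimit
open Literature.Probability.LatticeModels
open Literature.MathematicalPhysics.QuantumManyBody.StateRelaxation
open Summit.Ventures.CertifiedManyBodySolver.Theorems.WardSlot
open scoped ComplexOrder BigOperators

/-- The operator of a raw letter: `c^{(†)}_{xσ}` read in `Λ'` (zero if `x ∉ Λ'`; the checker's support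
conditions keep every letter of a passing certificate inside its frame). -/
def letterOp (Λ' : Finset (Site 2)) (ℓ : Letter) : FermionOp Λ' :=
  if h : ℓ.x ∈ Λ' then ladderLetter (orb (PolySite.pt ℓ.x h) ℓ.s, ℓ.dag) else 0

/-- The operator of a word: the ordered product of its letters. -/
def wordOp (Λ' : Finset (Site 2)) (w : Word) : FermionOp Λ' := (w.map (letterOp Λ')).prod

/-- The operator of a polynomial: `Σ q • wordOp w`. -/
def polyOp (Λ' : Finset (Site 2)) (p : QPoly) : FermionOp Λ' :=
  (p.map fun t => ((t.1 : ℚ) : ℂ) • wordOp Λ' t.2).sum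

/-- Support of a word inside a finite region (the `Prop` twin of `suppIn`). -/
def SuppIn (w : Word) (Λ : Finset (Site 2)) : Prop := ∀ ℓ ∈ w, ℓ.x ∈ Λ

/-- **W4 (the computational crux, parametrised by the bound `q`) — a Ward × `D₄` window certificate of
value `≥ q` exists at `(t, t', U, n) = (1, 0, 8, 7/8)`**, all index sets finite ordinals (checker-friendly
normal form). -/
def WardD4CertGe (q : ℝ) : Prop :=
  ∃ (Λ Λ' : Finset (Site 2)) (hΛ : Λ ⊆ Λ') (_h8 : thicken Λ 1 ⊆ Λ')
    (h0 : thicken ({0} : Finset (Site 2)) 1 ⊆ Λ') (hz : (0 : Site 2) ∈ Λ')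
    (μ : ℝ)
    (nm : ℕ) (Λm : Matrix (Fin nm) (Fin nm) ℂ) (_hΛm : Λm.PosSemidef) (O : Fin nm → FermionOp Λ')
    (ns : ℕ) (B : Fin ns → FermionOp Λ)
    (nt : ℕ) (γ : Fin nt → DihedralGroup 4) (wv : Fin nt → Site 2)
    (hsh : ∀ l, d4ShiftSet (γ l) (wv l) Λ ⊆ Λ') (Y : Fin nt → FermionOp Λ)
    (nu : ℕ) (b : Fin nu → ℂ) (cw : Fin nu → List (Orb (PolySite Λ') × Bool))
    (_hcw : ∀ j ∈ (Finset.univ : Finset (Fin nu)), ladderCharge (cw j) ≠ 0 ∨ ladderSpinCharge (cw j) ≠ 0)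
    (np : ℕ) (Xp : Fin np → FermionOp Λ') (nm' : ℕ) (Xm : Fin nm' → FermionOp Λ')
    (na : ℕ) (dc : Fin na → ℝ) (V : Fin na → FermionOp Λ')
    (nw : ℕ) (a : Fin nw → ℂ) (word : Fin nw → List (Orb (PolySite Λ') × Bool))
    (c : ℝ),
    WardD4Identity 1 0 8 (7 / 8) hΛ h0 hz μ Λm O Finset.univ B Finset.univ γ wv hsh Y Finset.univ b cw
      Finset.univ Xp Finset.univ Xm Finset.univ dc V Finset.univ a word c ∧
    q ≤ c - ∑ k, ‖a k‖

/-- **S1 (M; PROVED below, rev 2 — CAR only).**  The normal-orderer is faithful: for a word supported in `Λ'`,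
`wordOp w = polyOp (nfWord w)` in `𝔄_{Λ'}`.  Ingredients: `creation_anticomm`, `creation_mul_self`,
`annihilation_mul_creation` (`c_i c†_j = δ_ij − c†_j c_i`), `annihilation_anticommute_holds`,
`annihilation_mul_self` (FermionOperatorsProofs), and `Letter.modeEq a b = true ↔` same orbital of
`PolySite Λ'` (`PolySite.pt` and `orb` are injective).  Literature-landable as a generic lemma over any
`[LinearOrder ι] [Fintype ι]` with a Boolean comparison realising the order. -/
def NfFaithful : Prop :=
  ∀ (Λ' : Finset (Site 2)) (w : Word), SuppIn w Λ' → wordOp Λ' w = polyOp Λ' (nfWord w)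

/-- **S2 (M; PROVED below, rev 2 — relabelling).**  A licensed affine-`D₄` move of a word supported in the inner region is a
window identification term: both `u` and `γu + v` are embeddings of ONE `Y ∈ 𝔄_Λ` (namely the word read in
`Λ`), the second through `PolySite.d4Emb γ v Λ` — exactly the shape `Γ_{hsh}(Γ_{γ,v} Y)`, `Γ_{hΛ} Y` of the
family `tt` in `WardD4Identity`.  Ingredients: `fermionEmbed_ladderWord`, `Orb.embMap`,
`PolySite.ofLex_coe_d4Emb`, `d4R_eq_d4Vec`, `List.prod` of embeddings (`fermionEmbed` is multiplicative). -/
def MoveSound : Prop :=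
  ∀ (Λ Λ' : Finset (Site 2)) (hΛ : Λ ⊆ Λ') (γ : DihedralGroup 4) (v : Site 2)
    (hsh : d4ShiftSet γ v Λ ⊆ Λ') (u : Word), SuppIn u Λ →
    ∃ Y : FermionOp Λ, wordOp Λ' u = fermionEmbed (PolySite.incl hΛ) Y ∧
      wordOp Λ' (moveWord γ v u) =
        fermionEmbed (PolySite.incl hsh) (fermionEmbed (PolySite.d4Emb γ v Λ) Y)

section EvalP

variable {M : Type*} [AddCommGroup M] [Module ℂ M]

/-- Meaning of a formal `ℚ`-polynomial under a word semantics `f` (`polyOp Λ' = evalP (wordOp Λ')`). -/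
def evalP (f : Word → M) (p : QPoly) : M := (p.map fun t => ((t.1 : ℚ) : ℂ) • f t.2).sum

end EvalP

/-- Move every word of a polynomial by the affine `D₄` move `(γ, v)`. -/
def movePolyW (γ : DihedralGroup 4) (v : Site 2) (p : QPoly) : QPoly := p.map fun t => (t.1, moveWord γ v t.2)

/-- **S3 (M; PROVED in full as of rev 6 — TRUE iff Part A transcribes the cell correctly — the kernel demos `[H,N] = [H,S⁺] = 0` and the
toy certificates are partial evidence).**  The dictionary: on a repeat-free frame list, `hamPoly` evaluates to
the tree's local Hamiltonian of `hubbardTTPrimeFermionInteraction 1 0 8`, `energyPoly` to the embedded mean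
energy per site `Γ E_Φ`, `densPoly σ` to `n_{0σ}`, `spinPlusPoly`/`spinMinusPoly` to `S^±_{Λ'}`.
Ingredients: `FermionInteraction.localHamiltonian`, `meanEnergyObs`, `hubbardFermionInteraction_Φ`
(singletons `U n↑n↓`, nearest-neighbour pairs `−t Σ_σ(c†c + h.c.)`, `t' = 0` kills the diagonal pairs),
`Finset.sum` over `powerset` vs. `List.flatMap` over a `nodup` list. -/
def DictionarySound : Prop :=
  ∀ (frame : List (Site 2)), nodupSites frame = true →
    polyOp frame.toFinset (hamPoly frame) =
        (hubbardTTPrimeFermionInteraction 1 0 8).localHamiltonian frame.toFinset ∧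
    (∀ h0 : thicken ({0} : Finset (Site 2)) 1 ⊆ frame.toFinset,
        polyOp frame.toFinset energyPoly =
          fermionEmbed (PolySite.incl h0) ((hubbardTTPrimeFermionInteraction 1 0 8).meanEnergyObs 1)) ∧
    (∀ (hz : (0 : Site 2) ∈ frame.toFinset) (σ : Fin 2),
        polyOp frame.toFinset (densPoly σ) = nAt 0 hz σ) ∧
    polyOp frame.toFinset (spinPlusPoly frame) = (spinPlus : FermionOp frame.toFinset) ∧
    polyOp frame.toFinset (spinMinusPoly frame) = (spinMinus : FermionOp frame.toFinset)

/-- **S3a (M; the Hamiltonian conjunct of S3 — PROVED rev 6, below).** `hamPoly frame` (on-site `8·c†↑c↑c†↓c↓` per frame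
site + `−1·(c†_{xσ}c_{yσ} + c†_{yσ}c_{xσ})` per nearest-neighbour frame bond) evaluates to
`H_{Λ'} = Σ_{X ⊆ Λ'} Γ Φ(X)` of `hubbardTTPrimeFermionInteraction 1 0 8`.  Ingredients:
`FermionInteraction.localHamiltonian` (sum over `Λ'.powerset.attach`), `hubbardTTPrimeFermionInteraction_apply_singleton`
/ `_apply_pair_unitVec`, vanishing of `Φ X` on every other `X` (and of the `t' = 0` diagonal pairs), `fermionEmbed`
of `nAt`/`cAt` = the frame's `nAt`/`cAt` (`fermionEmbed_ladderLetter`), `Finset.sum` over the powerset vs. the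
`List.flatMap` over the `nodup` frame list (as in `dict_spinPlus` below). -/
def HamDictSound : Prop :=
  ∀ (frame : List (Site 2)), nodupSites frame = true →
    polyOp frame.toFinset (hamPoly frame) = (hubbardTTPrimeFermionInteraction 1 0 8).localHamiltonian frame.toFinset

/-- **S3b (M; the mean-energy conjunct of S3 — PROVED rev 5, below).** `energyPoly` (`8·n_{0↑}n_{0↓}` + the four half-weighted bonds
at the origin `−½ Σ_σ (c†_{0σ}c_{±e_iσ} + h.c.)`) evaluates to `Γ E_Φ`, `E_Φ = Σ_{X ∋ 0} Φ(X)/|X|` on `thicken {0} 1`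
embedded into the frame.  Ingredients: `FermionInteraction.meanEnergyObs` (filtered powerset sum, weights `|X|⁻¹ =
1, ½`), the same `Φ`-support facts as S3a, `fermionEmbed_comp` for `incl h0 ∘ incl`. -/
def EnergyDictSound : Prop :=
  ∀ (frame : List (Site 2)), nodupSites frame = true →
    ∀ h0 : thicken ({0} : Finset (Site 2)) 1 ⊆ frame.toFinset,
      polyOp frame.toFinset energyPoly =
        fermionEmbed (PolySite.incl h0) ((hubbardTTPrimeFermionInteraction 1 0 8).meanEnergyObs 1)

/-- The sites of `Λ'` and the ordered sites `PolySite Λ'` correspond. -/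
def sitesEquiv (Λ' : Finset (Site 2)) : Λ' ≃ PolySite Λ' where
  toFun x := PolySite.pt x.1 x.2
  invFun y := ⟨ofLex y.1, PolySite.ofLex_mem y⟩
  left_inv x := Subtype.ext (PolySite.ofLex_coe_pt x.1 x.2)
  right_inv y := PolySite.pt_ofLex y

/-- `Σ_σ c†_{xσ} c_{yσ}` for two sites of the frame. -/
def hopT (Λ' : Finset (Site 2)) (x y : {x // x ∈ Λ'}) : FermionOp Λ' :=
  ∑ σ : Fin 2, creation (orb (PolySite.pt x.1 x.2) σ) * annihilation (orb (PolySite.pt y.1 y.2) σ)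

/-- `n_{x↑} n_{x↓}` for a site of the frame. -/
def nnT (Λ' : Finset (Site 2)) (x : {x // x ∈ Λ'}) : FermionOp Λ' :=
  numberOp (PolySite.pt x.1 x.2) 0 * numberOp (PolySite.pt x.1 x.2) 1

/-- Soundness of the checker, as a statement: a passing syntactic certificate is a Ward × `D₄` window
certificate of value `symValue K` in the sense of line `wardk` (`WardD4CertGe`). -/
def SymCheckSound : Prop :=
  ∀ K : SymCert, symCheck K = true → WardD4CertGe ((symValue K : ℚ) : ℝ)

/-- A raw letter as an orbital letter of `Λ'` (junk orbital at `0` outside the frame). -/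
def orbLetter (Λ' : Finset (Site 2)) (hz : (0 : Site 2) ∈ Λ') (ℓ : Letter) : Orb (PolySite Λ') × Bool :=
  (if h : ℓ.x ∈ Λ' then orb (PolySite.pt ℓ.x h) ℓ.s else orb (PolySite.pt 0 hz) ℓ.s, ℓ.dag)

/-- A raw word as a tree ladder word. -/
def orbWord (Λ' : Finset (Site 2)) (hz : (0 : Site 2) ∈ Λ') (w : Word) : List (Orb (PolySite Λ') × Bool) :=
  w.map (orbLetter Λ' hz)

/-- `anchoredNFs` with the move `(γ, v)` remembered. -/
def anchoredMoves (corner : Site 2) (frame : List (Site 2)) (u : Word) :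
    List ((DihedralGroup 4 × Site 2) × QPoly) :=
  d4All.filterMap fun γ =>
    let v := flatSite (corner - minCorner (wordSites (moveWordF γ 0 u)))
    let w := moveWordF γ v u
    if suppIn w frame then some ((γ, v), nfWord w) else none

/-- The `polyKeyLt`-selection of `canonA`, on candidates carrying their move. -/
def selBest {α : Type*} (e : α × QPoly) (es : List (α × QPoly)) : α × QPoly :=
  es.foldl (fun b c => if polyKeyLt c.2 b.2 then c else b) e

/-- One identification USE `z • (wordOp (γu+v) − wordOp u)` (the `tt`-family currency of `WardD4Identity`
with `Y := z • u`). -/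
structure IdUse where
  z : ℚ
  u : Word
  γ : DihedralGroup 4
  v : Site 2

/-- The identification uses by which `canonTermA` replaces the term `t`: none (no anchored image fits),
one (`t ↦ best image`), or two halves (sign-odd word `↦ 0`). -/
def usesOfTerm (corner : Site 2) (frame : List (Site 2)) (t : ℚ × Word) : List IdUse :=
  match anchoredMoves corner frame t.2 with
  | [] => []
  | e :: es =>
    match (e :: es).find? (fun c => polyNegEq (selBest e es).2 c.2) with
    | some c => [⟨-t.1 / 2, t.2, (selBest e es).1.1, (selBest e es).1.2⟩, ⟨-t.1 / 2, t.2, c.1.1, c.1.2⟩]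
    | none => [⟨-t.1, t.2, (selBest e es).1.1, (selBest e es).1.2⟩]

/-- The operator of a use. -/
def useOp (Λ' : Finset (Site 2)) (e : IdUse) : FermionOp Λ' :=
  ((e.z : ℚ) : ℂ) • (wordOp Λ' (moveWord e.γ e.v e.u) - wordOp Λ' e.u)

/-- All words of a polynomial are supported in `Λ`. -/
def PSupp (p : QPoly) (Λ : Finset (Site 2)) : Prop := ∀ t ∈ p, SuppIn t.2 Λ

/-- The collected normal form of `LHS − RHS` (what `identityOK` canonicalises and tests). -/
def residual (K : SymCert) : QPoly := collect (nfPoly (psub (lhsPoly K) (rhsPoly K)))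

/-- The identification uses spent by the canonicaliser on the residual (none when `useCanon = false`). -/
def canonUses (K : SymCert) : List IdUse :=
  if K.useCanon then (residual K).flatMap (usesOfTerm (flatSite (minCorner K.frame)) K.frame) else []

/-- All identification uses of the certificate: explicit `moves` hints, then the canonicaliser's. -/
def ttList (K : SymCert) : List IdUse :=
  (K.moves.map fun mv => (⟨mv.z, mv.u, mv.γ, mv.v⟩ : IdUse)) ++ canonUses K

/-- **The enlarged frame `Λ'⁺`**: the king-move thickening of the frame together with every affine-`D₄`
image of the frame under a used move — so that each per-word licensed move is licensed for `Λ := frame`. -/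
def bigFrame (K : SymCert) : Finset (Site 2) :=
  thicken K.frame.toFinset 1 ∪ (ttList K).foldr (fun e S => d4ShiftSet e.γ e.v K.frame.toFinset ∪ S) ∅

/-- Dense coefficient of column `k` in a sparse row `[(ℓ, k)]`. -/
def rowCoef (r : List (ℚ × ℕ)) (k : ℕ) : ℚ := (r.map fun e => if e.2 = k then e.1 else 0).sum

/-- A column bound of a block (one past the largest column index of its rows). -/
def colBound (B : GramBlock) : ℕ := (B.rows.flatMap fun r => r.map Prod.snd).foldr max 0 + 1

/-- The pairs `(q_i, L_i)` of a block (as zipped by `gramBlockPoly`). -/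
abbrev blockPairs (B : GramBlock) : List (QPoly × List (ℚ × ℕ)) := B.basis.zip B.rows

/-- The dense complex factor `L` of a block. -/
def blockL (B : GramBlock) : Matrix (Fin (blockPairs B).length) (Fin (colBound B)) ℂ :=
  fun i k => ((rowCoef ((blockPairs B).get i).2 k : ℚ) : ℂ)

/-- The block's Gram multiplier `scale • L Lᴴ` (PSD by construction). -/
def blockMat (B : GramBlock) : Matrix (Fin (blockPairs B).length) (Fin (blockPairs B).length) ℂ :=
  ((B.scale : ℚ) : ℂ) • (blockL B * (blockL B)ᴴ)

/-- Combined Gram index: SOS factors ⊕ (block, basis element). -/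
abbrev GramIdx (K : SymCert) : Type :=
  Fin K.gram.length ⊕ ((b : Fin K.gramM.length) × Fin (blockPairs (K.gramM.get b)).length)

/-- Combined Gram multiplier: `diagonal d ⊕ blockDiagonal (scale_b • L_b L_bᴴ)`. -/
def gramMat (K : SymCert) : Matrix (GramIdx K) (GramIdx K) ℂ :=
  Matrix.fromBlocks (Matrix.diagonal fun k => (((K.gram.get k).1 : ℚ) : ℂ)) 0 0
    (Matrix.blockDiagonal' fun b => blockMat (K.gramM.get b))

/-- Generators of the matrix blocks. -/
def blockGen (K : SymCert) (Λ' : Finset (Site 2)) (b : Fin K.gramM.length)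
    (i : Fin (blockPairs (K.gramM.get b)).length) : FermionOp Λ' :=
  polyOp Λ' ((blockPairs (K.gramM.get b)).get i).1

/-- Combined Gram generators. -/
def gramGen (K : SymCert) (Λ' : Finset (Site 2)) : GramIdx K → FermionOp Λ' :=
  Sum.elim (fun k => polyOp Λ' (K.gram.get k).2)
    (fun p : (b : Fin K.gramM.length) × Fin (blockPairs (K.gramM.get b)).length => blockGen K Λ' p.1 p.2)

end Summit.Ventures.CertifiedManyBodySolver.Theorems.SymReplay

end
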